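/-
Copyright: lit-balaban Phase-2 proof seat p02 (gen 4).  Statement-level skeleton of a published paper; no proof claims beyond
what the kernel checks below.
-/
import Literature.MathematicalPhysics.QuantumFieldTheory.BalabanImbrieJaffe1984to88.BIJ88Eq220Proof
import Literature.MathematicalPhysics.QuantumFieldTheory.BalabanImbrieJaffe1984to88.BIJ85Prop511GaugeRG

/-!
# `BalabanImbrieJaffe1984to88.BIJ88Eq221Torus` — T. Bałaban, J. Imbrie, A. Jaffe, *Effective action and cluster properties
of the abelian Higgs model*, Commun. Math. Phys. **114** (1988) 257–315 [BalabanImbrieJaffe1988]: **(2.21)** p. 262,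
`H_{k,Ax}B = H_kB + ∂D_kB` — PROVED OUTRIGHT at the torus model instance (the hypothesis "Proposition I.5.1.1" of the knitting
`BIJ88Eq220Proof.eq221_gaugeRG` discharged by p30's `BIJ85Prop511GaugeRG.prop511_torusGaugeRG`)

statement-level skeleton of published theorems with citation tags; proofs where landed; nothing here is a claim about the Yang–Mills mass gap

PDF held: `paper:balaban1988-cmp114-bij-abelian-higgs-effective-action` (journal page = PDF page + 256), p. 262 [PDF 6];
(I) = [BalabanImbrieJaffe1985] (`paper:balaban1985-cmp97-bij-higgs-minimizers`), Prop. 5.1.1 p. 314 [PDF 16].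

CITATION HEADER (lean-in-tree rule).  Part of the lit-balaban TYPED SKELETON (HOME `run/shared/lean/pub/lit-balaban/`),
Phase-2 seat p02 (gen 4), row **C2.Eq2.21** of `HOME/SKELETON.md` (reader file `HOME/lit-balaban-r18/ROWS-C2.md`: *"typed
p239939 · knitted to (I.5.1.1) p247500"*).  p. 262, verbatim: *"The kernel C_k is constructed from the basic gauge transformation
D_k which changes the minimizer from axial to Landau gauge (I.5.1.1): H_{k,Ax}B = H_kB + ∂D_kB. (2.21)"*.  WHAT IS PROVED: on the
torus model instance `BIJ85Prop511GaugeRG.torusGaugeRG P hd k w distU Ck normCk` of r15's carrier `BIJ85Sect4Statements.GaugeRG`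
(unit-lattice bond fields on `T^{(k)}`, `H_{k,Ax}` = the axial minimizer (I.4.1.3), `H_k` = the Landau minimizer (I.4.4.2),
`∂ = grad L^k`, `D_kB := λ` of (I.5.1.4)), (2.21) holds for EVERY `B`, in the standing range `k ≤ m + K`, `w > 0`, `2 ≤ d`
(`eq221_torus`) — `BIJ88Eq220Proof.eq221_gaugeRG` with its hypothesis `GaugeRG.Prop511` supplied by
`BIJ85Prop511GaugeRG.prop511_torusGaugeRG` (p30 gen 4, p248847); and the corresponding ring-level statement
`BIJ88Sect2Statements.Eq221` in the ring of functions-to-operators reading used by `BIJ88Eq220Proof` is recorded pointwise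
(`eq221_torus_sub`).  Nothing else; the kernel data `distU`, `Ck`, `normCk` of (I.4.3.3)–(I.4.3.5) are parameters of the
instance and do not enter (2.21).  Unit `lit-balaban-p02` (literature-prover-lit-balaban-p02-g4-0), 2026-08-21.
-/

namespace Literature.MathematicalPhysics.QuantumFieldTheory.BalabanImbrieJaffe1984to88.BIJ88Eq221Torus

open Literature.MathematicalPhysics.QuantumFieldTheory.Balaban1983to89
open BIJ85Sect4Statements BIJ85Prop511GaugeRG

variable {P : Params}

/-- **(2.21) at the torus model instance**: `H_{k,Ax}B = H_kB + ∂D_kB` for every unit-lattice bond field `B` on `T^{(k)}`, with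
`D_kB = λ` of (I.5.1.4) — no hypothesis of printed shape left (standing range, `w > 0`, `2 ≤ d`).
[cite: BalabanImbrieJaffe1988, (2.21) p.262] -/
theorem eq221_torus (hd : 2 ≤ P.d) {k : ℕ} (hk : k ≤ P.m + P.K) {w : ℝ} (hw : 0 < w)
    (distU Ck : PBond P k → PBond P k → ℝ) (normCk : ℝ) (B : (torusGaugeRG P hd k w distU Ck normCk).FieldU) :
    (torusGaugeRG P hd k w distU Ck normCk).Hax B =
      (torusGaugeRG P hd k w distU Ck normCk).H B +
        (torusGaugeRG P hd k w distU Ck normCk).gradEta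
          ((torusGaugeRG P hd k w distU Ck normCk).mkGauge ((torusGaugeRG P hd k w distU Ck normCk).lam514 B)) :=
  BIJ88Eq220Proof.eq221_gaugeRG _ (prop511_torusGaugeRG hd hk hw distU Ck normCk) B

/-- The same in the difference form of (I.5.1.1), `H_{k,Ax}B − H_kB = ∂D_kB`, at the torus model instance.
[cite: BalabanImbrieJaffe1988, (2.21) p.262] -/
theorem eq221_torus_sub (hd : 2 ≤ P.d) {k : ℕ} (hk : k ≤ P.m + P.K) {w : ℝ} (hw : 0 < w)
    (distU Ck : PBond P k → PBond P k → ℝ) (normCk : ℝ) (B : (torusGaugeRG P hd k w distU Ck normCk).FieldU) :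
    (torusGaugeRG P hd k w distU Ck normCk).Hax B - (torusGaugeRG P hd k w distU Ck normCk).H B =
      (torusGaugeRG P hd k w distU Ck normCk).gradEta
        ((torusGaugeRG P hd k w distU Ck normCk).mkGauge ((torusGaugeRG P hd k w distU Ck normCk).lam514 B)) :=
  prop511_torusGaugeRG hd hk hw distU Ck normCk B

end Literature.MathematicalPhysics.QuantumFieldTheory.BalabanImbrieJaffe1984to88.BIJ88Eq221Torus
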